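import Literature.Computability.AlgebraicComplexity.StrongUSP
import Mathlib.Logic.Relation
import Mathlib.GroupTheory.OrderOfElement
import Mathlib.Logic.Equiv.Fin.Basic
import HarnessLib

/-!
# Simplifiable strong USPs (Anderson–Le 2023): definition, "simplifiable ⇒ strong USP", closure under
products and powers

Topic `Literature/Computability/AlgebraicComplexity` (group-theoretic matrix multiplication), namespace
`Literature.Computability.AlgebraicComplexity`.  Companion of `StrongUSP.lean` (`IsStrongUSP`, CKSU 2005 §3) and
`LocalStrongUSP.lean` (`IsLocalStrongUSP`, CKSU 2005 §6.1).

M. Anderson, V. Le, *Efficiently-Verifiable Strong Uniquely Solvable Puzzles and Matrix Multiplication*,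
COCOON 2023; arXiv:2307.06463 (held corpus text `paper:arxiv-2307.06463`), §2.2, §3 and §4:

* `USPSilent row` — the 3D graph `H_P` of a puzzle `P` (§2.2: "`E(H_P) = {(u,v,w) | f(u,v,w) = 0}`", `f = 1` iff some
  coordinate has exactly two of `uᵢ = 1, vᵢ = 2, wᵢ = 3`), as a ternary relation on the row indices of
  `row : ι → κ → Fin 3` (rows indexed by `ι`, columns by `κ`, symbols `1,2,3` coded `0,1,2`); its faces `R₀, R₁, R₂`
  (§3.2, `uspFace`); the set-induced simplification step of Lemma 4 / 5 (`USPInducesSimplification`, `uspSimplifyVia`);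
  "`H` simplifies to `H'`" (Def. 4 lifted to 3D graphs, §3.2: `USPSimplifiesTo`); **Definition 5** ("An `(s,k)`-puzzle `P`
  is a simplifiable SUSP if `H_P` simplifies to the trivial 3D perfect matching"): `IsSimplifiableSUSP`.
* The FIXED-POINT form used downstream (AL Lemma 6, "the complete simplification of H"): a 3D graph is `USPSupported`
  if each edge's three face-edges lie on closed walks of the faces; `IsSimplifiable row` says that every supported
  subgraph of `H_P` lies in the diagonal (with the diagonal present, "on a closed walk of the face" = "in a perfect
  matching of the face", the criterion of §3.3 / Algorithm 1).  `IsSimplifiableSUSP.isSimplifiable`: Definition 5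
  implies it (a set-induced step never deletes an edge of a supported subgraph, `USPSupported.sub_uspSimplifyVia`);
  everything below is proved for `IsSimplifiable`, hence holds for Definition 5.
* `IsSimplifiable.isStrongUSP` — §3.3 ("If `H_P` simplifies to the trivial matching, then … `P` is an SUSP"), for
  `Fin`-indexed puzzles and the tree's `IsStrongUSP`.
* `IsSimplifiable.prod` — **Lemma 8** ("Let `P₁, P₂` be simplifiable SUSPs, then `P₁ × P₂` is a simplifiable SUSP") for
  the row product `puzzleProd` of §4.2 (`P₁ × P₂ = {r₁ ∘ r₂}`; "`H_{P₁×P₂} = H_{P₁} × H_{P₂}`" = `uspSilent_puzzleProd_iff`);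
  `IsSimplifiable.pow` — **Corollary 5** (every power `P^N`, `puzzlePow`); `IsSimplifiable.reindex`.
* `IsLocalStrongUSP.isSimplifiable` — **Lemma 7** ("Every local SUSP is a simplifiable SUSP").

What is NOT here: **Theorem 2** (the ω-bound of a simplifiable `(s,k)`-SUSP) — it needs CKSU Cor. 16 for the powers
`P^N`, assembled census-side (`Summits/MatrixMultiplication/OmegaCensus/StrongUSPOmegaBound.lean`), and is proved there
(`SimplifiableSUSPOmegaBound.lean`: `omega_le_of_isSimplifiable`, with the link from the tree's closed-set certificate
checker to `IsSimplifiable`); Theorem 1 / Lemma 6 (the algorithm `Simplify`), Lemma 9, §5; the converse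
`IsSimplifiable → IsSimplifiableSUSP` (not needed).

## References
* M. Anderson, V. Le, COCOON 2023 (LNCS 14422); arXiv:2307.06463: §2.2 (`H_P`), Lemma 3 (= Anderson–Ji–Xu
  Lemma 5), §3.1 Lemma 4 and Def. 4, §3.2 Lemma 5, Cor. 3–4, §3.3 Def. 5, Lemma 6–7, §4.2 Lemma 8, Cor. 5,
  Thm. 2. [AndersonLe2023]
* H. Cohn, R. Kleinberg, B. Szegedy, C. Umans, FOCS 2005; arXiv:math/0511460, §3 (strong USPs).
  [CohnKleinbergSzegedyUmans2005]
-/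

namespace Literature.Computability.AlgebraicComplexity

open Equiv Relation

section General

variable {ι ι' κ κ' : Type*}

/-! ## The 3D graph `H_P`, its faces, set-induced simplification (AL §2.2, §3.1–3.2) -/

/-- The 3D graph `H_P` of a puzzle (Anderson–Le §2.2, after Anderson–Ji–Xu), as a ternary relation on row
indices: `(a,b,c)` is an edge ("silent" triple) iff NO coordinate has exactly two of `row a i = 1`,
`row b i = 2`, `row c i = 3` (symbols coded `0,1,2`; `USPExactlyTwo` of `StrongUSP.lean`).
[cite: AndersonLe2023, §2.2 (definition of H_P)] -/
def USPSilent (row : ι → κ → Fin 3) (a b c : ι) : Prop :=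
  ∀ i : κ, ¬ USPExactlyTwo (row a i) (row b i) (row c i)

/-- The diagonal ("trivial matching" `{(u,u,u) | u ∈ U}`, AL §2.2) lies in `H_P`: no symbol has exactly two of
`x = 1, x = 2, x = 3`. [cite: AndersonLe2023, §2.2 ("the trivial matching is a matching of H_P")] -/
theorem uspSilent_diag (row : ι → κ → Fin 3) (a : ι) : USPSilent row a a a := by
  intro i h
  rcases h with ⟨h0, h1, -⟩ | ⟨h0, -, h2⟩ | ⟨-, h1, h2⟩
  · rw [h0] at h1; exact absurd h1 (by decide)
  · rw [h0] at h2; exact absurd h2 (by decide)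
  · rw [h1] at h2; exact absurd h2 (by decide)

/-- The face-`f` edge of a triple (AL §3.2: `R₀ = {(v,w)}`, `R₁ = {(u,w)}`, `R₂ = {(u,v)}` — project out
coordinate `f`). [cite: AndersonLe2023, §3.2] -/
def uspFaceEdge (f : Fin 3) (u v w : ι) : ι × ι :=
  if f = 0 then (v, w) else if f = 1 then (u, w) else (u, v)

/-- The face `R_f` of a 3D graph `H` (AL §3.2): `(x,y) ∈ E(R_f)` iff it is the face-`f` edge of some edge of `H`.
[cite: AndersonLe2023, §3.2] -/
def uspFace (f : Fin 3) (H : ι → ι → ι → Prop) (x y : ι) : Prop :=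
  ∃ u v w, H u v w ∧ uspFaceEdge f u v w = (x, y)

/-- **AL Lemma 4, hypothesis** ("Let `S ⊆ U`, `E→ = S × (U−S)`, and `E← = (U−S) × S`. … If `E→ ∩ E(G) = ∅` or
`E← ∩ E(G) = ∅`"): the set `S` induces a simplification of the 2D graph `G` (no edge of `G` leaves `S`, or no
edge of `G` enters `S`). [cite: AndersonLe2023, Lemma 4] -/
def USPInducesSimplification (S : Set ι) (G : ι → ι → Prop) : Prop :=
  (∀ x y, G x y → x ∈ S → y ∈ S) ∨ (∀ x y, G x y → y ∈ S → x ∈ S)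

/-- **AL Lemma 5, the simplified 3D graph** `H' = H − U × ((S × (U−S)) ∪ ((U−S) × S))` via face `f`: keep an
edge iff its face-`f` edge does not cross between `S` and `U − S`. [cite: AndersonLe2023, Lemma 5] -/
def uspSimplifyVia (f : Fin 3) (S : Set ι) (H : ι → ι → ι → Prop) : ι → ι → ι → Prop :=
  fun u v w => H u v w ∧ ((uspFaceEdge f u v w).1 ∈ S ↔ (uspFaceEdge f u v w).2 ∈ S)

/-- **"`H` simplifies to `H'`"** (AL Definition 4, lifted to 3D graphs in §3.2: a finite sequence of set-induced
simplifications via faces `R_{f_j}`, each set `S_j` inducing a simplification of the current face).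
[cite: AndersonLe2023, Definition 4 and §3.2] -/
inductive USPSimplifiesTo : (ι → ι → ι → Prop) → (ι → ι → ι → Prop) → Prop
  | refl (H : ι → ι → ι → Prop) : USPSimplifiesTo H H
  | step (H H' : ι → ι → ι → Prop) (f : Fin 3) (S : Set ι) :
      USPInducesSimplification S (uspFace f H) → USPSimplifiesTo (uspSimplifyVia f S H) H' → USPSimplifiesTo H H'

/-- **Anderson–Le 2023, Definition 5 (Simplifiable SUSP)**, AS PRINTED: "An `(s,k)`-puzzle `P` is a simplifiable
SUSP if `H_P` simplifies to the trivial 3D perfect matching." [cite: AndersonLe2023, Definition 5] -/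
def IsSimplifiableSUSP (row : ι → κ → Fin 3) : Prop :=
  USPSimplifiesTo (USPSilent row) fun u v w => u = v ∧ v = w

/-! ## The fixed-point form: supported subgraphs -/

/-- A 3D graph `T` is *supported* if for every edge `(a,b,c)` each of its three face-edges lies on a closed walk
of the corresponding face of `T` (read as a digraph on the common domain): `c ⇝ b` in `R₀(T)`, `c ⇝ a` in
`R₁(T)`, `b ⇝ a` in `R₂(T)`.  With the diagonal present this says that every face-edge lies in a perfect
matching of its face — the edges kept by AL's complete simplification (§3.3, Algorithm 1, Lemma 6).
[cite: AndersonLe2023, §3.3 and Lemma 6] -/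
def USPSupported (T : ι → ι → ι → Prop) : Prop :=
  ∀ a b c, T a b c →
    ReflTransGen (uspFace 2 T) b a ∧ ReflTransGen (uspFace 1 T) c a ∧ ReflTransGen (uspFace 0 T) c b

/-- **Simplifiable puzzle, fixed-point form** of Anderson–Le's Definition 5: every supported subgraph of `H_P`
lies in the diagonal — i.e. the complete simplification of `H_P` (AL Lemma 6) is the trivial matching.
Definition 5 implies it: `IsSimplifiableSUSP.isSimplifiable`. [cite: AndersonLe2023, Definition 5 and Lemma 6] -/
def IsSimplifiable (row : ι → κ → Fin 3) : Prop :=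
  ∀ T : ι → ι → ι → Prop, (∀ a b c, T a b c → USPSilent row a b c) → USPSupported T →
    ∀ a b c, T a b c → a = b ∧ a = c

/-- A property closed under `r`-steps propagates along `ReflTransGen r`. [folklore] -/
private theorem reflTransGen_closed {α : Type*} {r : α → α → Prop} {P : α → Prop}
    (hP : ∀ x y, r x y → P x → P y) {a b : α} (h : ReflTransGen r a b) (ha : P a) : P b := by
  induction h with
  | refl => exact ha
  | tail _ hbc ih => exact hP _ _ hbc ih

/-- Unfolding of the face `R₂ = {(u,v)}`. [cite: AndersonLe2023, §3.2] -/
theorem uspFace_two_iff (H : ι → ι → ι → Prop) (x y : ι) : uspFace 2 H x y ↔ ∃ w, H x y w := by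
  simp only [uspFace, uspFaceEdge, Fin.isValue, Fin.reduceEq, ↓reduceIte, Prod.mk.injEq]
  constructor
  · rintro ⟨u, v, w, h, rfl, rfl⟩; exact ⟨w, h⟩
  · rintro ⟨w, h⟩; exact ⟨x, y, w, h, rfl, rfl⟩

/-- Unfolding of the face `R₁ = {(u,w)}`. [cite: AndersonLe2023, §3.2] -/
theorem uspFace_one_iff (H : ι → ι → ι → Prop) (x y : ι) : uspFace 1 H x y ↔ ∃ v, H x v y := by
  simp only [uspFace, uspFaceEdge, Fin.isValue, Fin.reduceEq, ↓reduceIte, Prod.mk.injEq]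
  constructor
  · rintro ⟨u, v, w, h, rfl, rfl⟩; exact ⟨v, h⟩
  · rintro ⟨v, h⟩; exact ⟨x, v, y, h, rfl, rfl⟩

/-- Unfolding of the face `R₀ = {(v,w)}`. [cite: AndersonLe2023, §3.2] -/
theorem uspFace_zero_iff (H : ι → ι → ι → Prop) (x y : ι) : uspFace 0 H x y ↔ ∃ u, H u x y := by
  simp only [uspFace, uspFaceEdge, Fin.isValue, ↓reduceIte, Prod.mk.injEq]
  constructor
  · rintro ⟨u, v, w, h, rfl, rfl⟩; exact ⟨u, h⟩
  · rintro ⟨u, h⟩; exact ⟨u, x, y, h, rfl, rfl⟩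

/-- Faces are monotone in the 3D graph. [cite: AndersonLe2023, §3.2] -/
theorem uspFace_mono {f : Fin 3} {T H : ι → ι → ι → Prop} (hTH : ∀ a b c, T a b c → H a b c) {x y : ι}
    (h : uspFace f T x y) : uspFace f H x y := by
  obtain ⟨u, v, w, huvw, he⟩ := h
  exact ⟨u, v, w, hTH _ _ _ huvw, he⟩

/-- `uspFaceEdge` commutes with maps applied to the three vertices. [cite: AndersonLe2023, §3.2] -/
theorem uspFaceEdge_map {ι₂ : Type*} (φ : ι → ι₂) (f : Fin 3) (u v w : ι) :
    uspFaceEdge f (φ u) (φ v) (φ w) = Prod.map φ φ (uspFaceEdge f u v w) := by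
  unfold uspFaceEdge
  split_ifs <;> rfl

/-- In a supported 3D graph the face-`f` edge `(x,y)` of every edge closes up: `y ⇝ x` in `R_f`.
[cite: AndersonLe2023, §3.3] -/
theorem USPSupported.walk {T : ι → ι → ι → Prop} (hT : USPSupported T) (f : Fin 3) {a b c : ι} (h : T a b c) :
    ReflTransGen (uspFace f T) (uspFaceEdge f a b c).2 (uspFaceEdge f a b c).1 := by
  obtain ⟨h2, h1, h0⟩ := hT a b c h
  fin_cases f
  · simpa [uspFaceEdge] using h0
  · simpa [uspFaceEdge] using h1
  · simpa [uspFaceEdge] using h2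

/-- **A set-induced step keeps every supported subgraph** (AL Lemma 4/5 in fixed-point language): if `T ⊆ H` is
supported and `S` induces a simplification of the face `R_f(H)`, then `T ⊆ H'`: the face-`f` edge `(x,y)` of an
edge of `T` lies on a closed walk `y ⇝ x` of `R_f(T) ⊆ R_f(H)`, which cannot cross between `S` and `U − S`.
[cite: AndersonLe2023, Lemma 4 and Lemma 5] -/
theorem USPSupported.sub_uspSimplifyVia {T H : ι → ι → ι → Prop} (hT : USPSupported T)
    (hTH : ∀ a b c, T a b c → H a b c) {f : Fin 3} {S : Set ι} (hS : USPInducesSimplification S (uspFace f H)) :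
    ∀ a b c, T a b c → uspSimplifyVia f S H a b c := by
  intro a b c habc
  refine ⟨hTH _ _ _ habc, ?_⟩
  have hxy : uspFace f T (uspFaceEdge f a b c).1 (uspFaceEdge f a b c).2 := ⟨a, b, c, habc, rfl⟩
  have hyx := hT.walk f habc
  rcases hS with hcl | hcl
  · exact ⟨hcl _ _ (uspFace_mono hTH hxy),
      fun hy => reflTransGen_closed (fun p q hpq hp => hcl p q (uspFace_mono hTH hpq) hp) hyx hy⟩
  · refine ⟨fun hx => ?_, hcl _ _ (uspFace_mono hTH hxy)⟩
    by_contra hy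
    exact reflTransGen_closed (P := fun z => z ∉ S)
      (fun p q hpq hp hq => hp (hcl p q (uspFace_mono hTH hpq) hq)) hyx hy hx

/-- Along a simplification sequence `H ⇝ H'`, every supported subgraph of `H` is a subgraph of `H'` (the
fixed-point form of AL Corollary 3). [cite: AndersonLe2023, Corollary 3] -/
theorem USPSimplifiesTo.supported_sub {H H' : ι → ι → ι → Prop} (hs : USPSimplifiesTo H H')
    {T : ι → ι → ι → Prop} (hT : USPSupported T) (hTH : ∀ a b c, T a b c → H a b c) :
    ∀ a b c, T a b c → H' a b c := by
  induction hs with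
  | refl H => exact hTH
  | step H H' f S hS _ ih => exact ih (hT.sub_uspSimplifyVia hTH hS)

/-- **Definition 5 implies the fixed-point form**: if `H_P` simplifies to the trivial matching then every supported
subgraph of `H_P` is diagonal. [cite: AndersonLe2023, Definition 5 and Corollary 3] -/
theorem IsSimplifiableSUSP.isSimplifiable {row : ι → κ → Fin 3} (h : IsSimplifiableSUSP row) :
    IsSimplifiable row := by
  intro T hT hS a b c habc
  obtain ⟨hab, hbc⟩ := USPSimplifiesTo.supported_sub h hS hT a b c habc
  exact ⟨hab, hab.trans hbc⟩

/-- **Anderson–Le 2023, Lemma 7** ("Every local SUSP `P` is a simplifiable SUSP": `H_P` has no edges except where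
`u = v = w`), in fixed-point form for the tree's `IsLocalStrongUSP`. [cite: AndersonLe2023, Lemma 7] -/
theorem IsLocalStrongUSP.isSimplifiable {s k : ℕ} {row : Fin s → Fin k → Fin 3} (h : IsLocalStrongUSP row) :
    IsSimplifiable row := by
  intro T hT _ a b c habc
  by_contra hne
  have hne' : a ≠ b ∨ b ≠ c := by
    by_cases hab : a = b
    · right; intro hbc; exact hne ⟨hab, hab.trans hbc⟩
    · exact Or.inl hab
  obtain ⟨i, hi⟩ := h a b c hne'
  exact hT a b c habc i ((uspExactlyTwo_iff_mem_localStrongUSPPatterns _ _ _).2 hi)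

/-! ## Products and powers (Anderson–Le §4.2) -/

/-- The product puzzle `P₁ × P₂ = {r₁ ∘ r₂ | r₁ ∈ P₁, r₂ ∈ P₂}` (AL §4.2): rows indexed by pairs, a row being the
concatenation of a row of `P₁` (columns `inl`) and a row of `P₂` (columns `inr`). [cite: AndersonLe2023, §4.2] -/
def puzzleProd (row : ι → κ → Fin 3) (row' : ι' → κ' → Fin 3) : ι × ι' → κ ⊕ κ' → Fin 3 :=
  fun p => Sum.elim (row p.1) (row' p.2)

/-- The `N`-th power puzzle `P^N` (AL §4.2: "the Cartesian product of `P` with itself `m` times … an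
`(s^m, k·m)`-puzzle"): rows indexed by `N`-tuples `Fin N → ι` of rows, columns by `Fin N × κ`.
[cite: AndersonLe2023, §4.2] -/
def puzzlePow (row : ι → κ → Fin 3) (N : ℕ) : (Fin N → ι) → Fin N × κ → Fin 3 :=
  fun v p => row (v p.1) p.2

/-- `H_{P₁ × P₂} = H_{P₁} × H_{P₂}` (AL, proof of Lemma 8: "the transformation of puzzles to 3D graphs is a
homomorphism"): a product triple is silent iff both component triples are. [cite: AndersonLe2023, Lemma 8 (proof)] -/
theorem uspSilent_puzzleProd_iff (row : ι → κ → Fin 3) (row' : ι' → κ' → Fin 3) (a b c : ι × ι') :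
    USPSilent (puzzleProd row row') a b c ↔ USPSilent row a.1 b.1 c.1 ∧ USPSilent row' a.2 b.2 c.2 := by
  simp only [USPSilent, puzzleProd, Sum.forall, Sum.elim_inl, Sum.elim_inr]

/-- `H_{P^N} = (H_P)^N`: a power triple is silent iff every component triple is. [cite: AndersonLe2023, §4.2] -/
theorem uspSilent_puzzlePow_iff (row : ι → κ → Fin 3) (N : ℕ) (f g h : Fin N → ι) :
    USPSilent (puzzlePow row N) f g h ↔ ∀ n : Fin N, USPSilent row (f n) (g n) (h n) := by
  simp only [USPSilent, puzzlePow, Prod.forall]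

/-- **Anderson–Le 2023, Lemma 8** ("Let `P₁, P₂` be simplifiable SUSPs, then `P₁ × P₂` is a simplifiable SUSP."),
fixed-point form: a supported subgraph of `H_{P₁} × H_{P₂}` projects to supported subgraphs of the two factors,
which are diagonal. [cite: AndersonLe2023, Lemma 8] -/
theorem IsSimplifiable.prod {row : ι → κ → Fin 3} {row' : ι' → κ' → Fin 3}
    (h : IsSimplifiable row) (h' : IsSimplifiable row') : IsSimplifiable (puzzleProd row row') := by
  intro T hT hS a b c habc
  -- the two projections of `T`
  let T₁ : ι → ι → ι → Prop := fun x y z => ∃ x' y' z', T (x, x') (y, y') (z, z')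
  let T₂ : ι' → ι' → ι' → Prop := fun x' y' z' => ∃ x y z, T (x, x') (y, y') (z, z')
  have hT₁ : ∀ x y z, T₁ x y z → USPSilent row x y z := by
    rintro x y z ⟨x', y', z', hx⟩
    exact ((uspSilent_puzzleProd_iff row row' _ _ _).1 (hT _ _ _ hx)).1
  have hT₂ : ∀ x' y' z', T₂ x' y' z' → USPSilent row' x' y' z' := by
    rintro x' y' z' ⟨x, y, z, hx⟩
    exact ((uspSilent_puzzleProd_iff row row' _ _ _).1 (hT _ _ _ hx)).2
  -- face-edges project
  have lface : ∀ (f : Fin 3) (p q : ι × ι'), uspFace f T p q → uspFace f T₁ p.1 q.1 ∧ uspFace f T₂ p.2 q.2 := by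
    rintro f ⟨x, x'⟩ ⟨y, y'⟩ ⟨⟨u, u'⟩, ⟨v, v'⟩, ⟨w, w'⟩, huvw, he⟩
    fin_cases f <;>
      simp only [uspFaceEdge, Fin.isValue] at he <;>
      obtain ⟨⟨rfl, rfl⟩, ⟨rfl, rfl⟩⟩ := he
    · exact ⟨⟨u, x, y, ⟨u', x', y', huvw⟩, by simp [uspFaceEdge]⟩, ⟨u', x', y', ⟨u, x, y, huvw⟩, by simp [uspFaceEdge]⟩⟩
    · exact ⟨⟨x, v, y, ⟨x', v', y', huvw⟩, by simp [uspFaceEdge]⟩, ⟨x', v', y', ⟨x, v, y, huvw⟩, by simp [uspFaceEdge]⟩⟩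
    · exact ⟨⟨x, y, w, ⟨x', y', w', huvw⟩, by simp [uspFaceEdge]⟩, ⟨x', y', w', ⟨x, y, w, huvw⟩, by simp [uspFaceEdge]⟩⟩
  have hS₁ : USPSupported T₁ := by
    rintro x y z ⟨x', y', z', hxyz⟩
    obtain ⟨h2, h1, h0⟩ := hS _ _ _ hxyz
    exact ⟨h2.lift Prod.fst fun p q hpq => (lface 2 p q hpq).1,
      h1.lift Prod.fst fun p q hpq => (lface 1 p q hpq).1,
      h0.lift Prod.fst fun p q hpq => (lface 0 p q hpq).1⟩
  have hS₂ : USPSupported T₂ := by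
    rintro x' y' z' ⟨x, y, z, hxyz⟩
    obtain ⟨h2, h1, h0⟩ := hS _ _ _ hxyz
    exact ⟨h2.lift Prod.snd fun p q hpq => (lface 2 p q hpq).2,
      h1.lift Prod.snd fun p q hpq => (lface 1 p q hpq).2,
      h0.lift Prod.snd fun p q hpq => (lface 0 p q hpq).2⟩
  obtain ⟨e1, e1'⟩ := h T₁ hT₁ hS₁ a.1 b.1 c.1 ⟨a.2, b.2, c.2, habc⟩
  obtain ⟨e2, e2'⟩ := h' T₂ hT₂ hS₂ a.2 b.2 c.2 ⟨a.1, b.1, c.1, habc⟩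
  exact ⟨Prod.ext e1 e2, Prod.ext e1' e2'⟩

/-- **Anderson–Le 2023, Corollary 5** ("Let `P` be a simplifiable SUSP, `P` generates an infinite family of
simplifiable SUSPs", i.e. every power `P^N` is a simplifiable SUSP), fixed-point form: a supported subgraph of
`H_{P^N}` projects, coordinate by coordinate, to supported subgraphs of `H_P`. [cite: AndersonLe2023, Corollary 5] -/
theorem IsSimplifiable.pow {row : ι → κ → Fin 3} (h : IsSimplifiable row) (N : ℕ) :
    IsSimplifiable (puzzlePow row N) := by
  intro T hT hS f g hh hfgh
  -- projection to coordinate `n`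
  let Tn : Fin N → ι → ι → ι → Prop := fun n x y z => ∃ f g hh, T f g hh ∧ f n = x ∧ g n = y ∧ hh n = z
  have hTn : ∀ n x y z, Tn n x y z → USPSilent row x y z := by
    rintro n x y z ⟨f, g, hh, hT', rfl, rfl, rfl⟩
    exact (uspSilent_puzzlePow_iff row N f g hh).1 (hT _ _ _ hT') n
  have lface : ∀ (n : Fin N) (e : Fin 3) (p q : Fin N → ι), uspFace e T p q → uspFace e (Tn n) (p n) (q n) := by
    rintro n e p q ⟨u, v, w, huvw, he⟩
    refine ⟨u n, v n, w n, ⟨u, v, w, huvw, rfl, rfl, rfl⟩, ?_⟩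
    rw [uspFaceEdge_map (fun v : Fin N → ι => v n), he]
    rfl
  have hSn : ∀ n, USPSupported (Tn n) := by
    rintro n x y z ⟨f, g, hh, hT', rfl, rfl, rfl⟩
    obtain ⟨h2, h1, h0⟩ := hS _ _ _ hT'
    exact ⟨h2.lift (fun v => v n) fun p q hpq => lface n 2 p q hpq,
      h1.lift (fun v => v n) fun p q hpq => lface n 1 p q hpq,
      h0.lift (fun v => v n) fun p q hpq => lface n 0 p q hpq⟩
  have key : ∀ n, f n = g n ∧ f n = hh n :=
    fun n => h (Tn n) (hTn n) (hSn n) (f n) (g n) (hh n) ⟨f, g, hh, hfgh, rfl, rfl, rfl⟩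
  exact ⟨funext fun n => (key n).1, funext fun n => (key n).2⟩

/-- Simplifiability is invariant under re-indexing rows and columns along equivalences (puzzles are SETS of rows,
AL §2 / §4.2: the product and power puzzles are defined up to such re-indexing). [cite: AndersonLe2023, §4.2] -/
theorem IsSimplifiable.reindex {ι₂ κ₂ : Type*} {row : ι → κ → Fin 3} (h : IsSimplifiable row)
    (e : ι₂ ≃ ι) (g : κ₂ ≃ κ) : IsSimplifiable fun a j => row (e a) (g j) := by
  intro T hT hS a b c habc
  let T' : ι → ι → ι → Prop := fun x y z => T (e.symm x) (e.symm y) (e.symm z)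
  have hT' : ∀ x y z, T' x y z → USPSilent row x y z := by
    intro x y z hx i
    have := hT _ _ _ hx (g.symm i)
    simpa [T'] using this
  have lface : ∀ (f : Fin 3) (p q : ι₂), uspFace f T p q → uspFace f T' (e p) (e q) := by
    rintro f p q ⟨u, v, w, huvw, he⟩
    refine ⟨e u, e v, e w, by simpa [T'] using huvw, ?_⟩
    rw [uspFaceEdge_map e, he]
    rfl
  have hS' : USPSupported T' := by
    intro x y z hx
    obtain ⟨h2, h1, h0⟩ := hS _ _ _ hx
    have h2' : ReflTransGen (uspFace 2 T') (e (e.symm y)) (e (e.symm x)) :=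
      h2.lift e fun p q hpq => lface 2 p q hpq
    have h1' : ReflTransGen (uspFace 1 T') (e (e.symm z)) (e (e.symm x)) :=
      h1.lift e fun p q hpq => lface 1 p q hpq
    have h0' : ReflTransGen (uspFace 0 T') (e (e.symm z)) (e (e.symm y)) :=
      h0.lift e fun p q hpq => lface 0 p q hpq
    simp only [Equiv.apply_symm_apply] at h2' h1' h0'
    exact ⟨h2', h1', h0'⟩
  have := h T' hT' hS' (e a) (e b) (e c) (by simpa [T'] using habc)
  exact ⟨e.injective this.1, e.injective this.2⟩

end General

/-! ## Simplifiable ⇒ strong USP (Anderson–Le §3.3) -/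

/-- Along the orbit of a permutation of a finite type one returns to the start: if `R x (π x)` for all `x`, then
`π x ⇝ x` in `R`. [folklore] -/
private theorem reflTransGen_perm_apply_self {α : Type*} [Fintype α] [DecidableEq α] (π : Perm α)
    {R : α → α → Prop} (hR : ∀ x, R x (π x)) (x : α) : ReflTransGen R (π x) x := by
  have key : ∀ j : ℕ, ReflTransGen R (π x) ((π ^ (j + 1)) x) := by
    intro j
    induction j with
    | zero => simp only [zero_add, pow_one]; exact ReflTransGen.refl
    | succ j ih =>
        refine ih.tail ?_
        rw [pow_succ' π (j + 1), Perm.mul_apply]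
        exact hR _
  have hpos : 0 < orderOf π := orderOf_pos π
  have h := key (orderOf π - 1)
  rwa [Nat.sub_add_cancel hpos, pow_orderOf_eq_one, Perm.one_apply] at h

/-- **Simplifiable SUSPs are SUSPs** (Anderson–Le §3.3: "If `H_P` simplifies to the trivial matching, then, by
Corollary 3, `H_P` has no nontrivial matchings, and, by Lemma 3, `P` is an SUSP"), for the fixed-point form and
the tree's `IsStrongUSP`: with `π₁ = 1` (`isStrongUSP_iff_fix_first`), a pair `(σ, τ)` all of whose triples
`(u, σu, τu)` are silent spans a supported subgraph of `H_P` (its closed walks are the orbits of `σ`, `τ`,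
`τσ⁻¹`), hence lies in the diagonal: `σ = τ = 1`. [cite: AndersonLe2023, §3.3 and Lemma 3] -/
theorem IsSimplifiable.isStrongUSP {s k : ℕ} {row : Fin s → Fin k → Fin 3} (h : IsSimplifiable row) :
    IsStrongUSP row := by
  rw [isStrongUSP_iff_fix_first]
  intro σ τ
  by_cases hex : ∃ u : Fin s, ∃ i : Fin k, USPExactlyTwo (row u i) (row (σ u) i) (row (τ u) i)
  · exact Or.inr hex
  · left
    simp only [not_exists] at hex
    let T : Fin s → Fin s → Fin s → Prop := fun a b c => b = σ a ∧ c = τ a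
    have hT : ∀ a b c, T a b c → USPSilent row a b c := by rintro a b c ⟨rfl, rfl⟩ i; exact hex a i
    have hS : USPSupported T := by
      rintro a b c ⟨rfl, rfl⟩
      refine ⟨?_, ?_, ?_⟩
      · refine reflTransGen_perm_apply_self σ (R := uspFace 2 T) (fun x => ?_) a
        exact (uspFace_two_iff T _ _).2 ⟨τ x, rfl, rfl⟩
      · refine reflTransGen_perm_apply_self τ (R := uspFace 1 T) (fun x => ?_) a
        exact (uspFace_one_iff T _ _).2 ⟨σ x, rfl, rfl⟩
      · have h3 := reflTransGen_perm_apply_self (τ * σ⁻¹) (R := uspFace 0 T)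
          (fun y => (uspFace_zero_iff T _ _).2 ⟨σ⁻¹ y, by simp [T, Perm.mul_apply]⟩) (σ a)
        simpa [Perm.mul_apply] using h3
    have key : ∀ a : Fin s, a = σ a ∧ a = τ a := fun a => h T hT hS a (σ a) (τ a) ⟨rfl, rfl⟩
    exact ⟨Equiv.ext fun a => ((key a).1).symm, Equiv.ext fun a => ((key a).2).symm⟩

/-- Definition 5 implies strong USP (AL §3.3 verbatim, via the fixed-point form). [cite: AndersonLe2023, §3.3] -/
theorem IsSimplifiableSUSP.isStrongUSP {s k : ℕ} {row : Fin s → Fin k → Fin 3} (h : IsSimplifiableSUSP row) :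
    IsStrongUSP row := h.isSimplifiable.isStrongUSP

end Literature.Computability.AlgebraicComplexity
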